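import Literature.Barriers.AtomisticToContinuum.AnticontinuumLocalizationThm2
import Literature.Barriers.AtomisticToContinuum.AnticontinuumLocalizationProofs
import HarnessLib

/-!
# Discharge of `RotorChain.GibbsStationarity`; Theorem 2 from Theorem 1 and (7.1) alone

`Literature/Barriers/AtomisticToContinuum/` — the named fact `RotorChain.GibbsStationarity` of
`AnticontinuumLocalizationThm2.lean` (stationarity of the Gibbs state of the rotor chain under its
Hamiltonian flow: Liouville's theorem + conservation of energy + the torus periodicity,
[cite: Arnold1978, §16 Thm 1], invoked without proof in De Roeck–Huveneers §7) is DISCHARGED by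
the theorem `RotorChain.IsFlow.stationary` of `AnticontinuumLocalizationProofs.lean` (landed for
the Theorem 4 reduction: Liouville by symplectic-Euler splitting, two fundamental domains of the
lattice `(2πℤ)^N`), whose statement is literally the body of the fact.

Consequently the reduction of the barrier fact `DeRoeckHuveneers2015_thm2` needs only two inputs:
`DeRoeckHuveneers2015_thm2_of_thm1_of_decorrelation :
  DeRoeckHuveneers2015_thm1 → DeRoeckHuveneers2015_decorrelation → DeRoeckHuveneers2015_thm2`
(Theorem 1 = §§3–6 of the paper; (7.1) = Ledoux/Helffer decorrelation at small coupling).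
-/

noncomputable section

namespace Literature.Barriers.AtomisticToContinuum

namespace HeatConduction.RotorChain

/-- **Discharge of the named fact `GibbsStationarity`**: for every `N`, `ε`, `γ`, `T > 0`, every
flow map of the rotor chain and every measurable angle-periodic `F ≥ 0`,
`⟨F ∘ X^t⟩_T = ⟨F⟩_T` — by `RotorChain.IsFlow.stationary` (Liouville + conservation of energy +
fundamental domains; the hypothesis `0 < T` is not even needed). [cite: Arnold1978, §16 Thm 1] -/
theorem GibbsStationarity_holds : GibbsStationarity :=
  fun _N _ε _γ T _hT _Φ hΦ => hΦ.stationary T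

end HeatConduction.RotorChain

open HeatConduction.RotorChain in
/-- **Theorem 2 from Theorem 1 and the decorrelation inequality (7.1).** With stationarity of the
Gibbs state proved (`GibbsStationarity_holds`), the barrier fact `DeRoeckHuveneers2015_thm2`
follows from the decomposition of the current (Theorem 1) and (7.1) alone, by the printed proof
(`DeRoeckHuveneers2015_thm2_of_thm1`). [cite: DeRoeckHuveneers2015, §7 proof of Thm 2] -/
theorem DeRoeckHuveneers2015_thm2_of_thm1_of_decorrelation (h1 : DeRoeckHuveneers2015_thm1)
    (hD : DeRoeckHuveneers2015_decorrelation) : DeRoeckHuveneers2015_thm2 :=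
  DeRoeckHuveneers2015_thm2_of_thm1 h1 GibbsStationarity_holds hD

end Literature.Barriers.AtomisticToContinuum

end
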